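/-
Copyright: the b2b-balaban cell (near-miss cell 7), T⁴-continuum CRUX team (coordinator ruling e34b3e0c item (2)),
seat t4-ne7b-formalise-leaf-01 (gen 28). Released under the licence of the surrounding project.
-/
import Summits.QuantumFields.BalabanUV.T4Continuum.Spine.NE7b.NonAbelianStokesBound
import Literature.MathematicalPhysics.QuantumFieldTheory.Sweep1

/-!
# (NAS) the lattice non-abelian Stokes INEQUALITY, part 2: the `Sweep1` reading, (FF) forced flux, and the `S³` carrier
# (route NE7b R-H ∕ C-RH°, `t4/ROUTES-NE7b.md` v7 §1 (NAS), (FF); §6 «[NEW-elementary, K-typable], OFFERED not typed»)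

Cell `pub-balaban`, sub-cell `t4`, spine estimate NE7b (node U5c), candidate route R-H. Part 1 (`NonAbelianStokesBound`) proved
(NAS) for the coordinate rectangle on the lattice words of `B7Prop1Explicit`:
`dist1 V(∂R_{n,K}(x)) ≤ Σ_{j<K} Σ_{i<n} dist1 V(∂p_{κμ}(x + i e_κ + j e_μ))` (`dist1_hol_rectWord_le_sum`). This file:

* §1 READS it on `Sweep1`'s objects — `ZdGaugeConfig.line ∕ plaquette ∕ rectangle` (the vocabulary of the PH-k chain
  `QuaternionBianchiDefect` … `EnergyQuantumLemma` of leaf-06 and of the Chatterjee-side files): the dictionary `line_eq_hol_seg`,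
  `plaquette_eq_hol_plaqWord`, `rectangle_eq_hol_rectWord` (`LatticeModels.Site d = Fin d → ℤ` definitionally, `curry U x μ = U (x, μ)`)
  and **`dist1_rectangle_le_sum`**: `dist1 (U.rectangle x i j R T) ≤ Σ_{s<R} Σ_{t<T} dist1 (U.plaquette (x + s eᵢ + t eⱼ) i j)`;
* §2 proves **(FF) «forced flux»** of ROUTES-NE7b v7 §1 — *«if `γ ⊂ coll` bounds a disc `D ⊂ H ∪ coll` and the exterior has
  holonomy `h` along `γ`, then EVERY filling satisfies `max_{p∈D∩H}|U_p − 1| ≥ (|h − 1| − #(D∩coll)·a) ∕ #(D∩H)`»* — as the finite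
  arithmetic `exists_le_of_le_sum_add_sum` (any index set split `A ∪ B`, valid for every disc shape once its (NAS) is supplied) and
  its rectangle instance **`forcedFlux_rectangle`** (plaquettes of the `R × T` rectangle split by a decidable `inH`);
* §3 the carrier of the PH-k chain, the unit quaternions `S³ = Metric.sphere (0 : ℍ) 1`: a LOCAL `GaugeGroup` structure
  `sphereGaugeGroup` (`dist1 q := ‖q − 1‖` — ROUTES v7's «bi-invariant size, Euclidean norm on unit quaternions»; `reTr q := re q`;
  a reducible `def`, NOT a global instance) and the plain-norm readings **`sphere_norm_rectangle_sub_one_le_sum`** ∕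
  **`sphere_forcedFlux_rectangle`**. On `SU(2) = Matrix.specialUnitaryGroup (Fin 2) ℂ` the tree's instance
  (`UnitaryModel.instGaugeGroupSpecialUnitaryGroup`) has `dist1 U = ‖U − 1‖` (operator norm; `BlockAveragingSU2.dist1_eq_norm`,
  `rfl`), so §1–§2 apply to `SU(2)` configurations as stated.

HONEST FRAMING. Law-free algebra about ONE lattice configuration; no measure, no effective action, no constant of
[Bałaban 1983–89] asserted or cited; nothing of bill A∕B's arithmetic or of (MP<L²); (TC)∕(TC-box) and W-hol NOT treated. NE7b
(`T4WeightBudget.RelWeightBound`) NOT PRINTED, NOT PROVED; spine PROVED 0∕9; rung (B)+1 on a FINITE torus T⁴ — NOT infinite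
volume, NOT the mass gap, NOT Clay. HONEST DEPENDENCY: continuum YM on T⁴ ⇐ BetaPertH ∧ nine spine estimates (0/9 proved);
BetaPertH ⇐ (D1) ∧ (D4) ∧ CAP+tail; G-an2-4 gates asym, D1 and NE2/3/4. POLICY: crux-route work under `Spine/NE7b/` (ROUTES v7
§6's named items (NAS)∕(FF); coordinator FREEZE (0) respected: not a `T4Continuum/Support` leaf); two concrete definitions
(`curry`, `sphereGaugeGroup`), no `Prop`-valued fact, no `[cite:]`.
-/

set_option autoImplicit false

namespace Summit.QuantumFields.BalabanUV.T4Continuum.NE7b.NonAbelianStokesReading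

noncomputable section

open Literature.MathematicalPhysics.QuantumFieldTheory.Balaban1983to89 (GaugeGroup dist1)
open Literature.MathematicalPhysics.QuantumFieldTheory.Balaban1983to89.B7Prop1Explicit
  (Letter e stepHol stepHol_true stepHol_false hol hol_nil hol_cons seg seg_natCast plaqWord)
open Literature.MathematicalPhysics.QuantumFieldTheory (ZdGaugeConfig)
open Summit.QuantumFields.BalabanUV.T4Continuum.NE7b.NonAbelianStokesBound (rectWord hol_rectWord dist1_hol_rectWord_le_sum)

/-! ## §1 The `Sweep1` reading: `ZdGaugeConfig.line ∕ plaquette ∕ rectangle` -/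

section Sweep1Reading

variable {d : ℕ} {G : Type*}

/-- A `Sweep1` configuration `U : ZdEdge d → G` read as the curried bond field `V(x, μ) = U (x, μ)` of `B7Prop1Explicit`
(`LatticeModels.Site d = Fin d → ℤ` definitionally). -/
abbrev curry (U : ZdGaugeConfig d G) : (Fin d → ℤ) → Fin d → G := fun x μ => U (x, μ)

/-- `n • e_k = Pi.single k n` on `ℤ^d`. -/
theorem natCast_smul_e (k : Fin d) (n : ℕ) : ((n : ℤ) • e k : Fin d → ℤ) = Pi.single k (n : ℤ) := by
  ext i
  simp [e, Pi.single_apply]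

section AnyGroup

variable [Group G] (U : ZdGaugeConfig d G)

/-- `Sweep1`'s straight-line holonomy is `B7Prop1Explicit.hol` along `seg`: `U.line k n y = V(seg k n; y)`. -/
theorem line_eq_hol_seg (k : Fin d) : ∀ (n : ℕ) (y : Fin d → ℤ), ZdGaugeConfig.line U k n y = hol (curry U) y (seg k n)
  | 0, y => by simp [ZdGaugeConfig.line]
  | n + 1, y => by
    rw [ZdGaugeConfig.line, seg_natCast, List.replicate_succ, hol_cons, ← seg_natCast, ← line_eq_hol_seg k n, stepHol_true,
      Letter.vec_true]
    rfl

/-- `Sweep1`'s plaquette holonomy is `B7Prop1Explicit.hol` along `plaqWord`: `U.plaquette x i j = V(∂p_{ij}(x))`. -/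
theorem plaquette_eq_hol_plaqWord (x : Fin d → ℤ) (i j : Fin d) :
    ZdGaugeConfig.plaquette U x i j = hol (curry U) x (plaqWord i j) := by
  simp only [ZdGaugeConfig.plaquette, plaqWord, hol_cons, hol_nil, mul_one, stepHol_true, stepHol_false, Letter.vec_true,
    Letter.vec_false, curry, mul_assoc]
  have h1 : x + e i + e j + -e i - e j = x := by abel
  have h2 : x + e i + e j - e i = x + e j := by abel
  rw [h1, h2]
  rfl

/-- `Sweep1`'s rectangular Wilson loop is `B7Prop1Explicit.hol` along `rectWord`: `U.rectangle x i j R T = V(∂R_{R,T}(x))`. -/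
theorem rectangle_eq_hol_rectWord (x : Fin d → ℤ) (i j : Fin d) (R T : ℕ) :
    ZdGaugeConfig.rectangle U x i j R T = hol (curry U) x (rectWord i j R T) := by
  rw [hol_rectWord, ZdGaugeConfig.rectangle, line_eq_hol_seg, line_eq_hol_seg, line_eq_hol_seg, line_eq_hol_seg,
    natCast_smul_e, natCast_smul_e]

end AnyGroup

variable [GaugeGroup G] (U : ZdGaugeConfig d G)

/-- **(NAS) FOR `Sweep1` RECTANGLES**: for any configuration `U : ZdGaugeConfig d G` with values in a `GaugeGroup`,
`dist1 (U.rectangle x i j R T) ≤ Σ_{s<R} Σ_{t<T} dist1 (U.plaquette (x + s eᵢ + t eⱼ) i j)` — the size of the `R × T` Wilson loop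
is at most the sum of the sizes of its `RT` plaquettes. -/
theorem dist1_rectangle_le_sum (x : Fin d → ℤ) (i j : Fin d) (R T : ℕ) :
    dist1 (ZdGaugeConfig.rectangle U x i j R T) ≤ ∑ s ∈ Finset.range R, ∑ t ∈ Finset.range T,
      dist1 (ZdGaugeConfig.plaquette U (x + Pi.single i (s : ℤ) + Pi.single j (t : ℤ)) i j) := by
  rw [rectangle_eq_hol_rectWord, Finset.sum_comm]
  refine (dist1_hol_rectWord_le_sum (curry U) x i j R T).trans (le_of_eq ?_)
  refine Finset.sum_congr rfl fun t _ => Finset.sum_congr rfl fun s _ => ?_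
  rw [plaquette_eq_hol_plaqWord, natCast_smul_e, natCast_smul_e]

/-- Uniform corollary: if every plaquette of the rectangle has `dist1 ≤ ε` then `dist1 (U.rectangle x i j R T) ≤ R·T·ε`. -/
theorem dist1_rectangle_le_mul (x : Fin d → ℤ) (i j : Fin d) (R T : ℕ) {ε : ℝ}
    (h : ∀ s t : ℕ, s < R → t < T → dist1 (ZdGaugeConfig.plaquette U (x + Pi.single i (s : ℤ) + Pi.single j (t : ℤ)) i j) ≤ ε) :
    dist1 (ZdGaugeConfig.rectangle U x i j R T) ≤ R * (T * ε) := by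
  refine (dist1_rectangle_le_sum U x i j R T).trans ?_
  calc ∑ s ∈ Finset.range R, ∑ t ∈ Finset.range T, dist1 (ZdGaugeConfig.plaquette U (x + Pi.single i (s : ℤ) + Pi.single j (t : ℤ)) i j)
      ≤ ∑ s ∈ Finset.range R, ∑ t ∈ Finset.range T, ε :=
        Finset.sum_le_sum fun s hs => Finset.sum_le_sum fun t ht => h s t (Finset.mem_range.mp hs) (Finset.mem_range.mp ht)
    _ = R * (T * ε) := by simp

end Sweep1Reading

/-! ## §2 (FF) forced flux: the arithmetic and the rectangle instance -/

section ForcedFlux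

/-- **(FF), THE ARITHMETIC.** If a size `h` is at most a sum of sizes over a finite index set split as `A ∪ B`, and the sizes on `B`
are at most `a`, then some index in the non-empty part `A` carries at least the average deficit: `∃ p ∈ A, (h − |B|·a) ∕ |A| ≤ s p`
(ROUTES-NE7b v7 §1 (FF): `A = D ∩ H`, `B = D ∩ coll`, `a = a(e)`; valid for any disc shape once its (NAS) bound is supplied). -/
theorem exists_le_of_le_sum_add_sum {ι : Type*} {A B : Finset ι} (s : ι → ℝ) {h a : ℝ} (hA : A.Nonempty)
    (hle : h ≤ ∑ p ∈ A, s p + ∑ p ∈ B, s p) (hB : ∀ p ∈ B, s p ≤ a) :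
    ∃ p ∈ A, (h - B.card * a) / A.card ≤ s p := by
  have hBsum : ∑ p ∈ B, s p ≤ B.card * a := by
    calc ∑ p ∈ B, s p ≤ ∑ _p ∈ B, a := Finset.sum_le_sum hB
      _ = B.card * a := by simp
  have hAsum : h - B.card * a ≤ ∑ p ∈ A, s p := by linarith
  have hcard : (0 : ℝ) < A.card := Nat.cast_pos.mpr hA.card_pos
  refine Finset.exists_le_of_sum_le hA ?_
  calc ∑ _p ∈ A, (h - B.card * a) / A.card = h - B.card * a := by
        rw [Finset.sum_const, nsmul_eq_mul, mul_div_cancel₀ _ hcard.ne']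
    _ ≤ ∑ p ∈ A, s p := hAsum

/-- The `max` form of the same: the largest size on `A` is at least the average deficit. -/
theorem div_le_sup'_of_le_sum_add_sum {ι : Type*} {A B : Finset ι} (s : ι → ℝ) {h a : ℝ} (hA : A.Nonempty)
    (hle : h ≤ ∑ p ∈ A, s p + ∑ p ∈ B, s p) (hB : ∀ p ∈ B, s p ≤ a) :
    (h - B.card * a) / A.card ≤ A.sup' hA s := by
  obtain ⟨p, hp, hle'⟩ := exists_le_of_le_sum_add_sum s hA hle hB
  exact hle'.trans (Finset.le_sup' s hp)

variable {d : ℕ} {G : Type*} [GaugeGroup G]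

/-- **(FF) FOR A RECTANGULAR DISC.** Let the `R × T` rectangle based at `x` in the `(i, j)`-plane have its plaquettes (indexed by
`(s, t)`, `s < R`, `t < T`) split by a decidable predicate `inH` («inside the healing domain») with the `inH`-part non-empty, and
suppose every plaquette OUTSIDE `inH` (the collar part) has `dist1 ≤ a`. Then some plaquette inside carries
`dist1 ≥ (dist1 (U.rectangle x i j R T) − #coll·a) ∕ #inH` — every filling of the hole agreeing with the collar data inherits the
loop's holonomy defect (ROUTES-NE7b v7 §1 (FF); with `a = 0` the floor is `|h − 1| ∕ A`). -/
theorem forcedFlux_rectangle (U : ZdGaugeConfig d G) (x : Fin d → ℤ) (i j : Fin d) (R T : ℕ)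
    (inH : ℕ × ℕ → Prop) [DecidablePred inH] {a : ℝ}
    (hH : ((Finset.range R ×ˢ Finset.range T).filter inH).Nonempty)
    (hcoll : ∀ st ∈ Finset.range R ×ˢ Finset.range T, ¬ inH st →
      dist1 (ZdGaugeConfig.plaquette U (x + Pi.single i (st.1 : ℤ) + Pi.single j (st.2 : ℤ)) i j) ≤ a) :
    ∃ st ∈ (Finset.range R ×ˢ Finset.range T).filter inH,
      (dist1 (ZdGaugeConfig.rectangle U x i j R T) -
          ((Finset.range R ×ˢ Finset.range T).filter (fun st => ¬ inH st)).card * a) /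
        ((Finset.range R ×ˢ Finset.range T).filter inH).card ≤
      dist1 (ZdGaugeConfig.plaquette U (x + Pi.single i (st.1 : ℤ) + Pi.single j (st.2 : ℤ)) i j) := by
  set D := Finset.range R ×ˢ Finset.range T with hD
  have hsum : dist1 (ZdGaugeConfig.rectangle U x i j R T) ≤
      ∑ st ∈ D.filter inH, dist1 (ZdGaugeConfig.plaquette U (x + Pi.single i (st.1 : ℤ) + Pi.single j (st.2 : ℤ)) i j) +
      ∑ st ∈ D.filter (fun st => ¬ inH st),
        dist1 (ZdGaugeConfig.plaquette U (x + Pi.single i (st.1 : ℤ) + Pi.single j (st.2 : ℤ)) i j) := by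
    rw [Finset.sum_filter_add_sum_filter_not, hD, Finset.sum_product]
    exact dist1_rectangle_le_sum U x i j R T
  exact exists_le_of_le_sum_add_sum _ hH hsum fun st hst =>
    hcoll st (Finset.mem_filter.mp hst).1 (Finset.mem_filter.mp hst).2

end ForcedFlux

/-! ## §3 The carrier of the PH-k chain: the unit quaternions `S³` -/

section Sphere

open Quaternion

/-- **`S³` AS A `GaugeGroup`** (a LOCAL structure, not a global instance): the unit quaternions `Metric.sphere (0 : ℍ) 1` with
their Mathlib group structure, `dist1 q := ‖q − 1‖` (the bi-invariant Euclidean size of ROUTES v7 (NAS)) and `reTr q := re q`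
(`= ½ Re tr` of the corresponding `SU(2)` matrix, cf. `SU2QuaternionBridge.re_trace_su2_eq_two_mul_re`). Use with
`letI := sphereGaugeGroup`. -/
@[reducible] def sphereGaugeGroup : GaugeGroup (Metric.sphere (0 : ℍ) 1) where
  toGroup := Metric.unitSphere.instGroup
  dist1 q := ‖(q : ℍ) - 1‖
  reTr q := (q : ℍ).re
  dist1_nonneg q := norm_nonneg _
  dist1_one := by simp [Metric.unitSphere.coe_one]
  dist1_inv q := by
    have hq : ‖(q : ℍ)‖ = 1 := mem_sphere_zero_iff_norm.mp q.2
    have hq0 : (q : ℍ) ≠ 0 := fun h => by rw [h, norm_zero] at hq; exact zero_ne_one hq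
    rw [Metric.unitSphere.coe_inv]
    calc ‖(q : ℍ)⁻¹ - 1‖ = ‖(q : ℍ)⁻¹ * (1 - (q : ℍ))‖ := by rw [mul_sub, mul_one, inv_mul_cancel₀ hq0]
      _ = ‖(q : ℍ) - 1‖ := by rw [norm_mul, norm_inv, hq, inv_one, one_mul, norm_sub_rev]
  dist1_conj g h := by
    have hh : ‖(h : ℍ)‖ = 1 := mem_sphere_zero_iff_norm.mp h.2
    have hh0 : (h : ℍ) ≠ 0 := fun h0 => by rw [h0, norm_zero] at hh; exact zero_ne_one hh
    rw [Metric.unitSphere.coe_mul, Metric.unitSphere.coe_mul, Metric.unitSphere.coe_inv]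
    calc ‖(h : ℍ) * (g : ℍ) * (h : ℍ)⁻¹ - 1‖ = ‖(h : ℍ) * ((g : ℍ) - 1) * (h : ℍ)⁻¹‖ := by
          rw [mul_sub, sub_mul, mul_one, mul_inv_cancel₀ hh0]
      _ = ‖(g : ℍ) - 1‖ := by rw [norm_mul, norm_mul, norm_inv, hh, inv_one, one_mul, mul_one]
  dist1_mul_le g h := by
    have hg : ‖(g : ℍ)‖ = 1 := mem_sphere_zero_iff_norm.mp g.2
    rw [Metric.unitSphere.coe_mul]
    calc ‖(g : ℍ) * (h : ℍ) - 1‖ = ‖(g : ℍ) * ((h : ℍ) - 1) + ((g : ℍ) - 1)‖ := by congr 1; noncomm_ring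
      _ ≤ ‖(g : ℍ) * ((h : ℍ) - 1)‖ + ‖(g : ℍ) - 1‖ := norm_add_le _ _
      _ = ‖(h : ℍ) - 1‖ + ‖(g : ℍ) - 1‖ := by rw [norm_mul, hg, one_mul]
      _ = ‖(g : ℍ) - 1‖ + ‖(h : ℍ) - 1‖ := add_comm _ _
  reTr_one := by simp [Metric.unitSphere.coe_one]
  reTr_le_one q := by
    have hq : ‖(q : ℍ)‖ = 1 := mem_sphere_zero_iff_norm.mp q.2
    have h1 : (q : ℍ).re * (q : ℍ).re ≤ ‖(q : ℍ)‖ * ‖(q : ℍ)‖ := by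
      rw [← Quaternion.normSq_eq_norm_mul_self, Quaternion.normSq_def']
      nlinarith [sq_nonneg (q : ℍ).imI, sq_nonneg (q : ℍ).imJ, sq_nonneg (q : ℍ).imK, sq_nonneg (q : ℍ).re]
    rw [hq, mul_one] at h1
    nlinarith
  reTr_inv q := by
    have hq : ‖(q : ℍ)‖ = 1 := mem_sphere_zero_iff_norm.mp q.2
    rw [Metric.unitSphere.coe_inv, Quaternion.inv_def, Quaternion.normSq_eq_norm_mul_self, hq, mul_one, inv_one, one_smul,
      Quaternion.re_star]
  reTr_conj g h := by
    have hh : ‖(h : ℍ)‖ = 1 := mem_sphere_zero_iff_norm.mp h.2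
    have hh0 : (h : ℍ) ≠ 0 := fun h0 => by rw [h0, norm_zero] at hh; exact zero_ne_one hh
    -- `re (a b) = re (b a)` (the tree's `BPST.re_mul_comm`, inlined to keep the import closure lattice-only)
    have hre : ∀ a b : ℍ, (a * b).re = (b * a).re := fun a b => by rw [Quaternion.re_mul, Quaternion.re_mul]; ring
    rw [Metric.unitSphere.coe_mul, Metric.unitSphere.coe_mul, Metric.unitSphere.coe_inv, hre, ← mul_assoc,
      inv_mul_cancel₀ hh0, one_mul]

/-- Under `sphereGaugeGroup`, `dist1 q = ‖q − 1‖` by definition. -/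
theorem sphere_dist1_eq (q : Metric.sphere (0 : ℍ) 1) : sphereGaugeGroup.dist1 q = ‖(q : ℍ) - 1‖ := rfl

variable {d : ℕ}

/-- **(NAS) ON `S³`-VALUED CONFIGURATIONS** (the carrier of the PH-k chain), in plain norm form:
`‖U(∂R_{R,T}) − 1‖ ≤ Σ_{s<R} Σ_{t<T} ‖U(∂p(x + s eᵢ + t eⱼ)) − 1‖`. -/
theorem sphere_norm_rectangle_sub_one_le_sum (U : ZdGaugeConfig d (Metric.sphere (0 : ℍ) 1)) (x : Fin d → ℤ) (i j : Fin d)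
    (R T : ℕ) :
    ‖((ZdGaugeConfig.rectangle U x i j R T : Metric.sphere (0 : ℍ) 1) : ℍ) - 1‖ ≤
      ∑ s ∈ Finset.range R, ∑ t ∈ Finset.range T,
        ‖((ZdGaugeConfig.plaquette U (x + Pi.single i (s : ℤ) + Pi.single j (t : ℤ)) i j : Metric.sphere (0 : ℍ) 1) : ℍ) - 1‖ := by
  letI : GaugeGroup (Metric.sphere (0 : ℍ) 1) := sphereGaugeGroup
  exact dist1_rectangle_le_sum U x i j R T

/-- **(FF) ON `S³`-VALUED CONFIGURATIONS**, plain norm form of `forcedFlux_rectangle`. -/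
theorem sphere_forcedFlux_rectangle (U : ZdGaugeConfig d (Metric.sphere (0 : ℍ) 1)) (x : Fin d → ℤ) (i j : Fin d) (R T : ℕ)
    (inH : ℕ × ℕ → Prop) [DecidablePred inH] {a : ℝ}
    (hH : ((Finset.range R ×ˢ Finset.range T).filter inH).Nonempty)
    (hcoll : ∀ st ∈ Finset.range R ×ˢ Finset.range T, ¬ inH st →
      ‖((ZdGaugeConfig.plaquette U (x + Pi.single i (st.1 : ℤ) + Pi.single j (st.2 : ℤ)) i j : Metric.sphere (0 : ℍ) 1) : ℍ)
        - 1‖ ≤ a) :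
    ∃ st ∈ (Finset.range R ×ˢ Finset.range T).filter inH,
      (‖((ZdGaugeConfig.rectangle U x i j R T : Metric.sphere (0 : ℍ) 1) : ℍ) - 1‖ -
          ((Finset.range R ×ˢ Finset.range T).filter (fun st => ¬ inH st)).card * a) /
        ((Finset.range R ×ˢ Finset.range T).filter inH).card ≤
      ‖((ZdGaugeConfig.plaquette U (x + Pi.single i (st.1 : ℤ) + Pi.single j (st.2 : ℤ)) i j : Metric.sphere (0 : ℍ) 1) : ℍ)
        - 1‖ := by
  letI : GaugeGroup (Metric.sphere (0 : ℍ) 1) := sphereGaugeGroup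
  exact forcedFlux_rectangle U x i j R T inH hH hcoll

end Sphere

end

end Summit.QuantumFields.BalabanUV.T4Continuum.NE7b.NonAbelianStokesReading
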